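import Literature.AlgebraicGeometry.HodgeTheory.DiagonalSymmetryEigenHodgeNumbers
import Literature.AlgebraicGeometry.HodgeTheory.FermatEigenspaceRestriction
import HarnessLib

/-!
# Eigen-Hodge numbers of a diagonal symmetry of a smooth hypersurface of ANY dimension via the
# Jacobian ring: the non-invariant eigenspaces, and the invariant line of hyperplane classes
# (Voisin II Thm. 6.10 / Cor. 6.12 read equivariantly; Carlson–Toledo 1999 §2, §5)

Family `hodge`, layer `Literature/AlgebraicGeometry/HodgeTheory`. PROOF FILE (theorems only; no
definition, no named fact; D-0026 net debt `0`). Sequel of `DiagonalSymmetryEigenHodgeNumbers`, whose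
main theorem `finrank_eigenspace_inf_piece_eq_of_residueKernel` — "the eigen-Hodge numbers of a
diagonal symmetry `σ_a` of a smooth hypersurface `Y = V₊(F) ⊂ ℙⁿ⁺¹` are
`dim (ker(σ_a^* ⊗ ℂ − μ) ∩ H^{n−q,q}(Y)) = dim (S^k)_μ − dim (J_F^k)_μ`, `k + n + 2 = (q+1)d`",
granted the residue-kernel package `Griffiths1969_residueKernel_eq_jacobianIdeal` (Voisin II
Thm. 6.10 / Cor. 6.12) — is stated for ODD `n` only (there `Hⁿ(ℙⁿ⁺¹) = 0`, so clause (ii) of the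
package, "`F^{n+1−l}Hⁿ(Y) ⊆ res_l(S^{ld−n−2}) + ι^*Hⁿ(ℙⁿ⁺¹)`", has no second term). Its module
docstring leaves "even `n` (add the `h^{n/2}` line)" as `TODO(general form)`; this file does it, in
the form needed by the EVEN-dimensional consumer of the tree — the `p`-cyclic covers
`X_F : x₃^p = f(x₀,x₁,x₂)` of the plane (SURFACES, `n = 2`) of Carlson–Toledo 1999, route
`CyclicUnitaryPowers` of the Hodge summit, whose two cited Hodge-number facts
`carlsonToledo1999_finrank_eigenspace_deck_one` (§2: "`H² = ℂ·h ⊕ H²_0`, `H²_0 = ⊕_{μ ≠ 1} H(μ)`":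
the covering group has a LINE of invariants) and `carlsonToledo1999_finrank_eigenspace_inf_hodgePiece`
(§5: the `ζ^i`-eigen-Hodge numbers are `dim R_f^{(q+1)p−3−i}`) are thereby reduced to the same
Griffiths package that the odd-dimensional sibling route `SignSymmetricPowers` consumes.

## What is proved (all `n ≥ 1`)

Write `L ⊆ ℂ ⊗_ℚ Hⁿ(Y(ℂ); ℚ)` for the hyperplane classes: the image of
`ι^* : Hⁿ(ℙⁿ⁺¹(ℂ); ℂ) → Hⁿ(Y(ℂ); ℂ)` transported along `β : ℂ ⊗_ℚ Hⁿ(Y; ℚ) ≅ Hⁿ(Y; ℂ)`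
(`ofRatClassBaseChangeEquiv`); it is spelled out in full in every statement (no definition).

* `baseChange_pull_diagonalAut_eq_self_of_mem_hyperplaneClasses` — **`σ_a^*` FIXES `L`**: a
  diagonal symmetry is the restriction of `[z] ↦ [a • z]`, which is homotopic to the identity of
  `ℙⁿ⁺¹(ℂ)` (the tree's `map_diagonalAut_map_hypersurfaceι`, Ran 1980 §1).
* `finrank_eigenspace_inf_piece_eq_of_residueKernel_of_ne_one` — **THE NON-INVARIANT EIGEN-HODGE
  NUMBERS, ANY `n`**: for `μ ≠ 1` the odd-dimensional formula holds verbatim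
  (`dim (E_μ ∩ H^{n−q,q}) = dim (S^k)_μ − dim (J_F^k)_μ`): in clause (ii) the extra term `L` lies in
  the `1`-eigenspace, so it drops out of the `μ`-component (independence of eigenspaces).
* `eigenspace_inf_piece_eq_bot_of_lt_of_ne_one` — below the Jacobian range (`(q+1)d < n+2`)
  `E_μ ∩ H^{n−q,q} = 0` for `μ ≠ 1` (granted the span package only).
* `eigenspace_one_eq_hyperplaneClasses_of_residueKernel` — **THE INVARIANT LINE**: if every
  `T_a`-INVARIANT numerator `P ∈ S^{ld−n−2}` (`1 ≤ l ≤ n+1`) lies in the Jacobian ideal `J_F` (for the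
  cyclic covers: `T_a x^e = ζ^{e₃+1} x^e` is invariant iff `p ∣ e₃ + 1`, forcing `x₃^{p−1} ∣ x^e`, and
  `x₃^{p−1} = p⁻¹ ∂F/∂x₃ ∈ J_F`), then the `1`-eigenspace of `σ_a^* ⊗ ℂ` on ALL of `Hⁿ(Y)` is exactly
  `L`: by descending induction on the Hodge level, `E_1 ∩ F^{n+1−l} ⊆ res_l((S^k)_1) + L` (clause
  (ii) and the eigen-decomposition of numerators), and `res_l((S^k)_1) ⊆ res_l(J_F) ⊆ F^{n+2−l}`
  (clause (iv), Thm. 6.10), which is `⊆ L` by induction; `F⁰ = Hⁿ`.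
* `finrank_eigenspace_one_eq_one_of_residueKernel` — hence for EVEN `n = 2m` (and `F` irreducible)
  **`dim_ℂ E_1 = 1`**: `ι^*` is injective on `H^{2m}(ℙ^{2m+1}(ℂ)) ≅ ℂ` (the tree's Lefschetz-type
  `map_ne_zero_of_le`, Voisin II Cor. 1.25, and `finrank_complexBetti_projectiveSpace_two_mul`);
  `finrank_eigenspace_pull_one_eq_one_of_residueKernel` — the same over `ℚ`
  (`dim_ℚ Hⁿ(Y(ℂ); ℚ)^{σ_a^*} = 1`, eigenspaces commute with `⊗ ℂ`: `finrank_eigenspace_baseChange_one`).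

## Faithfulness

The residue package is used only through its typed clauses (i)–(iv); the Hodge structure is the
tree's light form `BettiUniverse.hodge hHD hX n`; `hHD`, `hI` are the usual (proved) hypotheses. In
print: Carlson–Toledo §2 (held text p0005) "[the monodromy group] preserve[s] the hyperplane class and
the cup product […] `H^{n+1}(Y,ℂ)_0 = ⊕_{μ ≠ 1} H(μ)`"; §5 (p0011) "Residues with numerator
`y^{i−1}A(x)` and denominator `(y^k + P(x))^{q+1}` span the spaces `H^{p,q}_0(i)` […] the corresponding
space of numerator polynomials, taken modulo the Jacobian ideal of `P`, is isomorphic via the residue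
map to `H^{p,q}_0(i)`"; Voisin II Cor. 6.12 "`R_f^{pd−n−1} ≅ H^{n−p,p−1}(Y)_prim`". The invariant
eigenvalue `μ = 1` off the hypothesis of `eigenspace_one_eq_hyperplaneClasses_of_residueKernel`
(invariant numerators outside `J_F`, e.g. Fermat hypersurfaces under a sub-torus) is NOT treated:
there the primitive invariant part is non-zero and clause (ii) alone does not separate it from `L`.
-- TODO(general form): `μ = 1` with invariant numerators present (needs primitivity of residues).

## References

* [VoisinHodgeII2003] C. Voisin, Hodge Theory and Complex Algebraic Geometry II, CUP 2003, §1.2.3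
  Cor. 1.25, §6.1.3 Thm. 6.10, Cor. 6.12 (held text chunks p0159–p0161).
* [CarlsonToledo1999] J. A. Carlson, D. Toledo, Discriminant complements and kernels of monodromy
  representations, Duke Math. J. 97 (1999); arXiv alg-geom/9708002, §2 (held text p0005), §5
  (p0011–p0012).
* [Ran1980] Z. Ran, Cycles on Fermat hypersurfaces, Compositio Math. 42 (1980), §1 (1.1)–(1.3).
* [Shioda1981PicardNumber] T. Shioda, On the Picard number of a complex projective variety, Ann.
  Sci. ÉNS 14 (1981), §1 (1.4) (eigenspace decomposition; linear algebra).
* [GonzalezAguileraLiendoMonteroVillaflor2022] V. González-Aguilera, A. Liendo, P. Montero,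
  R. Villaflor Loyola, On a Torelli principle for automorphisms of Klein hypersurfaces,
  arXiv:2212.13308, proof of Thm. 5.5.
-/

noncomputable section

open CategoryTheory AlgebraicGeometry MvPolynomial
open scoped TensorProduct

namespace Literature.AlgebraicGeometry.HodgeTheory

open Literature.AlgebraicGeometry.Motives Literature.AlgebraicTopology.SingularHomology
open Literature.RingTheory.MvPolynomial (idealDegree mem_idealDegree)

/-! ### §0 Linear algebra: eigenvalue `1` commutes with extension of scalars -/

section LinearAlgebra

variable {V : Type*} [AddCommGroup V] [Module ℚ V]

/-- **`dim_ℂ ker(f ⊗ ℂ − 1) = dim_ℚ ker(f − 1)`**: the `1`-eigenspace commutes with the base change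
`ℚ → ℂ` (kernels commute with a flat base change, Mathlib `Module.Flat.ker_lTensor_eq`).
[cite: Shioda1981PicardNumber, §1 (1.4)] -/
theorem finrank_eigenspace_baseChange_one [Module.Finite ℚ V] (f : Module.End ℚ V) :
    Module.finrank ℂ ↥(Module.End.eigenspace (f.baseChange ℂ) 1) =
      Module.finrank ℚ ↥(Module.End.eigenspace f 1) := by
  have h1 : Module.End.eigenspace (f.baseChange ℂ) 1 = LinearMap.ker ((f - 1).baseChange ℂ) := by
    rw [Module.End.eigenspace_def, one_smul, LinearMap.baseChange_sub]
    congr 1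
    ext x
    simp
  have h2 : Module.End.eigenspace f 1 = LinearMap.ker (f - 1) := by
    rw [Module.End.eigenspace_def, one_smul]
  have h3 : LinearMap.ker ((f - 1).baseChange ℂ) = (LinearMap.ker (f - 1)).baseChange ℂ :=
    Module.Flat.ker_lTensor_eq ℂ ℂ (f - 1)
  rw [h1, h2, h3]
  have hinj : Function.Injective ((LinearMap.ker (f - 1)).subtype.baseChange ℂ) := by
    have h := Module.Flat.lTensor_preserves_injective_linearMap (M := ℂ)
      (LinearMap.ker (f - 1)).subtype (LinearMap.ker (f - 1)).injective_subtype
    rwa [← LinearMap.baseChange_eq_ltensor] at h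
  rw [Submodule.baseChange, LinearMap.finrank_range_of_inj hinj, Module.finrank_baseChange]

end LinearAlgebra

section HodgeTheory

variable {n d : ℕ} {F : MvPolynomial (Fin (n + 2)) ℂ}

/-! ### §1 The hyperplane classes are fixed by every diagonal symmetry -/

/-- **`σ_a^* ⊗ ℂ` fixes the hyperplane classes** `L = β⁻¹(ι^* Hⁿ(ℙⁿ⁺¹(ℂ); ℂ))`: the diagonal
symmetry `σ_a = diagonalAut F ha` satisfies `σ_a ≫ ι = ι ≫ ([z] ↦ [a • z])` and the latter acts
trivially on `H*(ℙⁿ⁺¹(ℂ))` (the tree's `map_diagonalAut_map_hypersurfaceι`; Carlson–Toledo §2: the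
automorphisms in play "preserve the hyperplane class"). [cite: Ran1980, §1 (1.1)–(1.3)]
[cite: CarlsonToledo1999, §2 (held text p0005)] -/
theorem baseChange_pull_diagonalAut_eq_self_of_mem_hyperplaneClasses
    (hX : IsSmoothProjective n (SmoothHypersurface.hypersurface F))
    {a : Fin (n + 2) → ℂˣ} (ha : a ∈ diagonalStabilizer F) (k : ℕ)
    {y : ℂ ⊗[ℚ] ↥(bettiCohomology (SmoothHypersurface.hypersurface F) k)}
    (hy : y ∈ (LinearMap.range (complexBetti.map (SmoothHypersurface.hypersurfaceι F) k).hom).map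
        (ofRatClassBaseChangeEquiv hX k).symm.toLinearMap) :
    (BettiUniverse.pull (diagonalAut F ha) k).baseChange ℂ y = y := by
  obtain ⟨z, hz, rfl⟩ := Submodule.mem_map.mp hy
  obtain ⟨η, rfl⟩ := LinearMap.mem_range.mp hz
  apply (ofRatClassBaseChangeEquiv hX k).injective
  have hβg : ∀ y, ofRatClassBaseChangeEquiv hX k ((BettiUniverse.pull (diagonalAut F ha) k).baseChange ℂ y) =
      complexBetti.map (diagonalAut F ha) k (ofRatClassBaseChangeEquiv hX k y) := fun y ↦
    HodgeModel.ofRatClassBaseChange_baseChange_map (diagonalAut F ha) k y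
  rw [hβg]
  simp only [LinearEquiv.coe_coe, LinearEquiv.apply_symm_apply]
  exact map_diagonalAut_map_hypersurfaceι F ha k η

/-- Consequently the hyperplane classes lie in the `1`-eigenspace of `σ_a^* ⊗ ℂ`.
[cite: CarlsonToledo1999, §2 (held text p0005)] -/
theorem hyperplaneClasses_le_eigenspace_one
    (hX : IsSmoothProjective n (SmoothHypersurface.hypersurface F))
    {a : Fin (n + 2) → ℂˣ} (ha : a ∈ diagonalStabilizer F) (k : ℕ) :
    (LinearMap.range (complexBetti.map (SmoothHypersurface.hypersurfaceι F) k).hom).map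
        (ofRatClassBaseChangeEquiv hX k).symm.toLinearMap ≤
      Module.End.eigenspace ((BettiUniverse.pull (diagonalAut F ha) k).baseChange ℂ) 1 := by
  intro y hy
  rw [Module.End.mem_eigenspace_iff, one_smul]
  exact baseChange_pull_diagonalAut_eq_self_of_mem_hyperplaneClasses hX ha k hy

/-! ### §2 The non-invariant eigen-Hodge numbers in every dimension -/

/-- **The eigen-Hodge numbers of a diagonal symmetry of a smooth hypersurface, eigenvalues `μ ≠ 1`,
ANY dimension `n ≥ 1`** (Voisin II Cor. 6.12 "`R_f^{pd−n−1} ≅ H^{n−p,p−1}(Y)_prim`" with the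
naturality `g_a^* Res(PΩ/Fˡ) = Res(T_a(P)Ω/Fˡ)`, granted the kernel package
`Griffiths1969_residueKernel_eq_jacobianIdeal`): for `a` in the diagonal stabiliser of `F`,
`σ_a = diagonalAut F ha`, `q ≤ n`, `k + (n + 2) = (q + 1) d` and `μ ≠ 1`:
`dim_ℂ (ker(σ_a^* ⊗ ℂ − μ) ∩ H^{n−q,q}(Y)) = dim_ℂ (S^k)_μ − dim_ℂ (J_F^k)_μ` (the `μ`-eigenspaces of
the twisted action `T_a P = (∏ aᵢ) P(a • x)`). Compared with the odd-dimensional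
`finrank_eigenspace_inf_piece_eq_of_residueKernel`, clause (ii) now reads
`F^{n−q} ⊆ res(S^k) + ι^*Hⁿ(ℙⁿ⁺¹)`, and the hyperplane classes are `σ_a^*`-invariant
(`baseChange_pull_diagonalAut_eq_self_of_mem_hyperplaneClasses`), so they do not contribute to the
`μ`-component for `μ ≠ 1` (Carlson–Toledo §5: the `ζ^i`-eigenspaces, `i ≢ 0`, lie in the primitive
cohomology and are computed by residues). [cite: VoisinHodgeII2003, §6.1.3 Thm. 6.10 and Cor. 6.12 (held text chunks p0159, p0161)]
[cite: CarlsonToledo1999, §5 (held text p0011–p0012)] -/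
theorem finrank_eigenspace_inf_piece_eq_of_residueKernel_of_ne_one
    (hG : Griffiths1969_residueKernel_eq_jacobianIdeal)
    (hHD : exists_isReal_hodgeModel) (hI : hodgePQ_independent_of_hodgeModel)
    (hn : 1 ≤ n) (hF : F.IsHomogeneous d)
    (hJ : ∀ z : Fin (n + 2) → ℂ, z ≠ 0 → MvPolynomial.eval z F = 0 →
      ∃ j, MvPolynomial.eval z (MvPolynomial.pderiv j F) ≠ 0)
    (hX : IsSmoothProjective n (SmoothHypersurface.hypersurface F))
    {a : Fin (n + 2) → ℂˣ} (ha : a ∈ diagonalStabilizer F) {μ : ℂ} (hμ : μ ≠ 1)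
    {q k : ℕ} (hq : q ≤ n) (hk : k + (n + 2) = (q + 1) * d) :
    Module.finrank ℂ ↥(Module.End.eigenspace ((BettiUniverse.pull (diagonalAut F ha) n).baseChange ℂ) μ ⊓
        (BettiUniverse.hodge hHD hX n).piece ((n : ℤ) - q) q) =
      Module.finrank ℂ ↥(Module.End.eigenspace (twistedDiagonalAction a) μ ⊓
          homogeneousSubmodule (Fin (n + 2)) ℂ k) -
        Module.finrank ℂ ↥(Module.End.eigenspace (twistedDiagonalAction a) μ ⊓
          idealDegree (UniversalHypersurface.jacobianIdeal F) k) := by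
  classical
  -- the data
  set X := SmoothHypersurface.hypersurface F with hXdef
  set A := BettiUniverse.realHodgeModel hHD hX with hAdef
  set H := BettiUniverse.hodge hHD hX n with hHdef
  set gC := (BettiUniverse.pull (diagonalAut F ha) n).baseChange ℂ with hgC
  set T := twistedDiagonalAction a with hTdef
  set Sk := homogeneousSubmodule (Fin (n + 2)) ℂ k with hSk
  set J := UniversalHypersurface.jacobianIdeal F with hJdef
  obtain ⟨res, h1, h2, h3, h4⟩ := hG n d hn F hF hJ hX A
  set β := ofRatClassBaseChangeEquiv hX n with hβ
  set L : Submodule ℂ (ℂ ⊗[ℚ] ↥(bettiCohomology X n)) :=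
    (LinearMap.range (complexBetti.map (SmoothHypersurface.hypersurfaceι F) n).hom).map
      β.symm.toLinearMap with hLdef
  set ρ : MvPolynomial (Fin (n + 2)) ℂ →ₗ[ℂ] ℂ ⊗[ℚ] ↥(bettiCohomology X n) :=
    β.symm.toLinearMap ∘ₗ res (q + 1) with hρ
  have hl1 : 1 ≤ q + 1 := Nat.le_add_left 1 q
  have hln : q + 1 ≤ n + 1 := Nat.add_le_add_right hq 1
  -- finite-dimensionality
  haveI : Module.Finite ℚ ↥(bettiCohomology X n) := BettiUniverse.finite hX n
  haveI : Module.Finite ℂ ↥Sk := Module.Finite.iff_fg.mpr (homogeneousSubmodule_fg (Fin (n + 2)) ℂ k)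
  -- (L1) membership in the Hodge filtration of `H` read in the model `A`
  have memF : ∀ (m : ℕ) (x : ℂ ⊗[ℚ] ↥(bettiCohomology X n)),
      x ∈ H.F (m : ℤ) ↔ A.pullback n (β x) ∈ A.hodgeFiltration n m := by
    intro m x
    rw [hHdef, BettiUniverse.hodge_F, HodgeModel.mem_ratF_iff, Int.toNat_natCast]
    rfl
  have hβρ : ∀ P, β (ρ P) = res (q + 1) P := fun P ↦ by
    rw [hρ, LinearMap.comp_apply, LinearEquiv.coe_toLinearMap, LinearEquiv.apply_symm_apply]
  -- indices
  have hidx1 : n + 1 - (q + 1) = n - q := by omega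
  have hidx2 : n + 2 - (q + 1) = n - q + 1 := by omega
  have hp : ((n - q : ℕ) : ℤ) = (n : ℤ) - q := by omega
  have hp1 : ((n - q + 1 : ℕ) : ℤ) = (n : ℤ) - q + 1 := by omega
  -- (L2) equivariance: `gC (ρ P) = ρ (T P)`
  have hβg : ∀ y, β (gC y) = complexBetti.map (diagonalAut F ha) n (β y) := fun y ↦
    HodgeModel.ofRatClassBaseChange_baseChange_map (diagonalAut F ha) n y
  have hequiv : ∀ P ∈ Sk, gC (ρ P) = ρ (T P) := by
    intro P hP
    apply β.injective
    rw [hβg, hβρ, hβρ, hTdef, twistedDiagonalAction_apply, map_smul]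
    exact h3 a ha (q + 1) k P hl1 hln hk ((mem_homogeneousSubmodule k P).mp hP)
  -- the hyperplane classes are invariant
  have hL1 : ∀ y ∈ L, gC y = y := fun y hy ↦
    baseChange_pull_diagonalAut_eq_self_of_mem_hyperplaneClasses hX ha n hy
  -- eigenvectors of `T` in `S^k` go to eigenvectors of `gC`
  have heig : ∀ (ν : ℂ) (P : MvPolynomial (Fin (n + 2)) ℂ), P ∈ Module.End.eigenspace T ν → P ∈ Sk →
      ρ P ∈ Module.End.eigenspace gC ν := by
    intro ν P hPν hP
    rw [Module.End.mem_eigenspace_iff, hequiv P hP, Module.End.mem_eigenspace_iff.mp hPν, map_smul]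
  -- (i') `ρ(S^k) ⊆ F^{n-q}`
  have hρF : ∀ P ∈ Sk, ρ P ∈ H.F ((n : ℤ) - q) := by
    intro P hP
    rw [← hp, memF, hβρ, ← hidx1]
    exact h1 (q + 1) k P hl1 hln hk ((mem_homogeneousSubmodule k P).mp hP)
  -- (iv') `ρ P ∈ F^{n-q+1} ↔ P ∈ J` on `S^k`
  have hρF1 : ∀ P ∈ Sk, (ρ P ∈ H.F ((n : ℤ) - q + 1) ↔ P ∈ J) := by
    intro P hP
    rw [← hp1, memF, hβρ, ← hidx2]
    exact h4 (q + 1) k P hl1 hln hk ((mem_homogeneousSubmodule k P).mp hP)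
  -- (ii') `F^{n-q} ⊆ ρ(S^k) + L`
  have hFρ : ∀ x ∈ H.F ((n : ℤ) - q), ∃ P ∈ Sk, ∃ y ∈ L, ρ P + y = x := by
    intro x hx
    rw [← hp, memF, ← hidx1] at hx
    have h2x := h2 (q + 1) hl1 hln (β x) hx
    have hsup : (⨆ (k' : ℕ) (_ : k' + (n + 2) = (q + 1) * d),
        (homogeneousSubmodule (Fin (n + 2)) ℂ k').map (res (q + 1))) = Sk.map (res (q + 1)) := by
      refine le_antisymm (iSup_le fun k' ↦ iSup_le fun hk' ↦ ?_) (le_iSup_of_le k (le_iSup_of_le hk le_rfl))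
      obtain rfl : k' = k := by omega
      exact le_rfl
    rw [hsup] at h2x
    obtain ⟨u, hu, z, hz, huz⟩ := Submodule.mem_sup.mp h2x
    obtain ⟨P, hP, rfl⟩ := Submodule.mem_map.mp hu
    refine ⟨P, hP, β.symm z, Submodule.mem_map_of_mem hz, ?_⟩
    apply β.injective
    rw [map_add, hβρ, LinearEquiv.apply_symm_apply, huz]
  -- the eigen-subspaces of polynomials
  set Sμ := Module.End.eigenspace T μ ⊓ Sk with hSμ
  set Jμ := Module.End.eigenspace T μ ⊓ idealDegree J k with hJμ
  have hJμ_le : Jμ ≤ Sμ := inf_le_inf_left _ inf_le_right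
  -- (X1) `E_μ ∩ F^{n-q} = ρ(S^k_μ)` (`μ ≠ 1`: the hyperplane part drops out)
  have X1 : Module.End.eigenspace gC μ ⊓ H.F ((n : ℤ) - q) = Sμ.map ρ := by
    refine le_antisymm ?_ ?_
    · rintro x ⟨hxE, hxF⟩
      obtain ⟨P, hP, y, hy, hPyx⟩ := hFρ x hxF
      -- decompose `P` into `T`-eigencomponents, and add `y` to the `1`-component
      set s := P.support.image (diagonalCharacter a) with hs
      set xf : ℂ → ℂ ⊗[ℚ] ↥(bettiCohomology X n) :=
        fun ν ↦ ρ (eigenComponent a ν P) + if ν = 1 then y else 0 with hxf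
      have hsumP : ∑ ν ∈ insert (1 : ℂ) s, ρ (eigenComponent a ν P) = ρ P := by
        by_cases h1s : (1 : ℂ) ∈ s
        · rw [Finset.insert_eq_of_mem h1s, ← map_sum, sum_eigenComponent a P]
        · rw [Finset.sum_insert h1s, eigenComponent_eq_zero_of_not_mem a h1s, map_zero, zero_add,
            ← map_sum, sum_eigenComponent a P]
      have hsumy : ∑ ν ∈ insert (1 : ℂ) s, (if ν = 1 then y else 0) = y := by
        rw [Finset.sum_ite_eq' (insert (1 : ℂ) s) (1 : ℂ) (fun _ ↦ y), if_pos (Finset.mem_insert_self _ _)]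
      have hsum : x = ∑ ν ∈ insert (1 : ℂ) s, xf ν := by
        rw [hxf, Finset.sum_add_distrib, hsumP, hsumy, hPyx]
      have hterms : ∀ ν ∈ insert (1 : ℂ) s, xf ν ∈ Module.End.eigenspace gC ν := by
        intro ν _
        refine Submodule.add_mem _ (heig ν _ (eigenComponent_mem_eigenspace a ν P)
          (eigenComponent_mem_homogeneousSubmodule a ν hP)) ?_
        split_ifs with hν1
        · rw [hν1, Module.End.mem_eigenspace_iff, one_smul]
          exact hL1 y hy
        · exact Submodule.zero_mem _
      have hxE' : ∑ ν ∈ insert (1 : ℂ) s, xf ν ∈ Module.End.eigenspace gC μ := hsum ▸ hxE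
      have key := sum_eq_of_sum_mem_eigenspace gC (insert (1 : ℂ) s) xf hterms hxE'
      rw [← hsum] at key
      rw [key]
      split_ifs with hμs
      · rw [hxf]
        dsimp only
        rw [if_neg hμ, add_zero]
        exact Submodule.mem_map_of_mem
          ⟨eigenComponent_mem_eigenspace a μ P, eigenComponent_mem_homogeneousSubmodule a μ hP⟩
      · exact Submodule.zero_mem _
    · rintro _ ⟨P, ⟨hPμ, hP⟩, rfl⟩
      exact ⟨heig μ P hPμ hP, hρF P hP⟩
  -- (X2) `E_μ ∩ F^{n-q+1} = ρ(J^k_μ)`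
  have X2 : Module.End.eigenspace gC μ ⊓ H.F ((n : ℤ) - q + 1) = Jμ.map ρ := by
    refine le_antisymm ?_ ?_
    · rintro x ⟨hxE, hxF1⟩
      have hxF : x ∈ H.F ((n : ℤ) - q) := H.antitone_F (by omega) hxF1
      have hx1 : x ∈ Module.End.eigenspace gC μ ⊓ H.F ((n : ℤ) - q) := ⟨hxE, hxF⟩
      rw [X1] at hx1
      obtain ⟨P, ⟨hPμ, hP⟩, rfl⟩ := Submodule.mem_map.mp hx1
      refine Submodule.mem_map_of_mem ⟨hPμ, ?_, hP⟩
      exact (hρF1 P hP).mp hxF1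
    · rintro _ ⟨P, ⟨hPμ, hPJ, hP⟩, rfl⟩
      exact ⟨heig μ P hPμ hP, (hρF1 P hP).mpr hPJ⟩
  -- (X3) `S^k_μ ∩ ker ρ = J^k_μ ∩ ker ρ`
  have X3 : Sμ ⊓ LinearMap.ker ρ = Jμ ⊓ LinearMap.ker ρ := by
    refine le_antisymm ?_ (inf_le_inf_right _ hJμ_le)
    rintro P ⟨⟨hPμ, hP⟩, hPker⟩
    refine ⟨⟨hPμ, ?_, hP⟩, hPker⟩
    refine (hρF1 P hP).mp ?_
    have h0 : ρ P = 0 := LinearMap.mem_ker.mp hPker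
    rw [h0]
    exact Submodule.zero_mem _
  -- (X4) `dim (E_μ ∩ F^{n-q}) = dim (E_μ ∩ V^{n-q,q}) + dim (E_μ ∩ F^{n-q+1})`
  have hpiece : H.F ((n : ℤ) - q) = H.F ((n : ℤ) - q + 1) ⊔ H.piece ((n : ℤ) - q) q := by
    have h := Motives.HodgeStructure.F_eq_F_succ_sup_piece H ((n : ℤ) - q)
    rwa [show (n : ℤ) - ((n : ℤ) - q) = q by ring] at h
  have hdisj : Disjoint (H.F ((n : ℤ) - q + 1)) (H.piece ((n : ℤ) - q) q) := by
    rw [disjoint_iff, inf_comm]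
    have h := Motives.HodgeStructure.piece_inf_F_succ_sup_complexConj_eq_bot H ((n : ℤ) - q)
    rw [show (n : ℤ) - ((n : ℤ) - q) = q by ring] at h
    refine le_bot_iff.mp (le_trans (inf_le_inf_left _ le_sup_left) h.le)
  set gH := BettiUniverse.pullHodgeHom hHD hI hX hX (diagonalAut F ha) n with hgH
  have hgH' : gH.toLinearMap.baseChange ℂ = gC := by
    rw [hgH, BettiUniverse.pullHodgeHom_toLinearMap]
  have hstabF : ∀ x ∈ H.F ((n : ℤ) - q + 1), gC x ∈ H.F ((n : ℤ) - q + 1) := fun x hx ↦ by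
    rw [← hgH']; exact gH.baseChange_mem_F _ hx
  have hstabW : ∀ x ∈ H.piece ((n : ℤ) - q) q, gC x ∈ H.piece ((n : ℤ) - q) q := fun x hx ↦ by
    rw [← hgH']; exact gH.baseChange_mem_piece hx
  have X4 := finrank_eigenspace_inf_sup_eq_of_disjoint gC hdisj hstabF hstabW μ
  rw [← hpiece, X1, X2] at X4
  -- rank–nullity
  haveI : FiniteDimensional ℂ ↥Sμ := Submodule.finiteDimensional_inf_right _ _
  haveI : FiniteDimensional ℂ ↥Jμ := Submodule.finiteDimensional_of_le hJμ_le
  have rS := finrank_map_add_finrank_inf_ker ρ Sμ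
  have rJ := finrank_map_add_finrank_inf_ker ρ Jμ
  rw [X3] at rS
  have d1 : Module.finrank ℂ ↥(Sμ.map ρ) = Module.finrank ℂ ↥(Jμ.map ρ) +
      Module.finrank ℂ ↥(Module.End.eigenspace gC μ ⊓ H.piece ((n : ℤ) - q) q) := X4
  have d2 : Module.finrank ℂ ↥(Sμ.map ρ) + Module.finrank ℂ ↥(Jμ ⊓ LinearMap.ker ρ) =
      Module.finrank ℂ ↥Sμ := rS
  have d3 : Module.finrank ℂ ↥(Jμ.map ρ) + Module.finrank ℂ ↥(Jμ ⊓ LinearMap.ker ρ) =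
      Module.finrank ℂ ↥Jμ := rJ
  have hle1 : Module.finrank ℂ ↥Jμ ≤ Module.finrank ℂ ↥Sμ := Submodule.finrank_mono hJμ_le
  clear X4 rS rJ
  omega

/-- **Below the Jacobian range the non-invariant eigen-Hodge pieces vanish, any dimension**: if
`(q + 1) d < n + 2` (no numerator degree `k` with `k + n + 2 = (q+1) d`) then
`E_μ ∩ H^{n−q,q}(Y) = 0` for `μ ≠ 1` — clause (ii) with an empty set of degrees leaves only the
hyperplane classes, which are `σ_a^*`-invariant. Granted the residue package only (e.g. `H^{2,0} = 0`
for a cubic surface). [cite: VoisinHodgeII2003, §6.1.3 (α_p) and Cor. 6.12 (held text chunks p0159, p0161)]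
[cite: CarlsonToledo1999, §5 (held text p0011–p0012)] -/
theorem eigenspace_inf_piece_eq_bot_of_lt_of_ne_one (hG : Griffiths1969_residues_span_hodgeFiltration)
    (hHD : exists_isReal_hodgeModel) (hn : 1 ≤ n) (hF : F.IsHomogeneous d)
    (hJ : ∀ z : Fin (n + 2) → ℂ, z ≠ 0 → MvPolynomial.eval z F = 0 →
      ∃ j, MvPolynomial.eval z (MvPolynomial.pderiv j F) ≠ 0)
    (hX : IsSmoothProjective n (SmoothHypersurface.hypersurface F))
    {a : Fin (n + 2) → ℂˣ} (ha : a ∈ diagonalStabilizer F) {μ : ℂ} (hμ : μ ≠ 1)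
    {q : ℕ} (hq : q ≤ n) (hlt : (q + 1) * d < n + 2) :
    Module.End.eigenspace ((BettiUniverse.pull (diagonalAut F ha) n).baseChange ℂ) μ ⊓
      (BettiUniverse.hodge hHD hX n).piece ((n : ℤ) - q) q = ⊥ := by
  have hn1 : 1 ≤ n := hn
  set A := BettiUniverse.realHodgeModel hHD hX with hAdef
  set β := ofRatClassBaseChangeEquiv hX n with hβ
  obtain ⟨res, -, h2, -⟩ := hG n d hn1 F hF hJ hX A
  have hl1 : 1 ≤ q + 1 := Nat.le_add_left 1 q
  have hln : q + 1 ≤ n + 1 := Nat.add_le_add_right hq 1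
  have hidx1 : n + 1 - (q + 1) = n - q := by omega
  have hp : ((n - q : ℕ) : ℤ) = (n : ℤ) - q := by omega
  refine eq_bot_iff.mpr ?_
  rintro x ⟨hxE, hxW⟩
  have hx : x ∈ (BettiUniverse.hodge hHD hX n).F ((n : ℤ) - q) :=
    Motives.HodgeStructure.piece_le_F _ _ _ hxW
  rw [← hp, BettiUniverse.hodge_F, HodgeModel.mem_ratF_iff, Int.toNat_natCast, ← hidx1] at hx
  have h2x := h2 (q + 1) hl1 hln _ hx
  have hsup : (⨆ (k' : ℕ) (_ : k' + (n + 2) = (q + 1) * d),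
      (homogeneousSubmodule (Fin (n + 2)) ℂ k').map (res (q + 1))) = ⊥ :=
    le_bot_iff.mp (iSup_le fun k' ↦ iSup_le fun hk' ↦ by omega)
  rw [hsup, bot_sup_eq] at h2x
  -- so `x` is a hyperplane class, hence invariant; but it is a `μ`-eigenvector, `μ ≠ 1`
  have hxL : x ∈ (LinearMap.range (complexBetti.map (SmoothHypersurface.hypersurfaceι F) n).hom).map
      β.symm.toLinearMap := by
    refine Submodule.mem_map.mpr ⟨_, h2x, ?_⟩
    exact β.symm_apply_apply x
  have hfix := baseChange_pull_diagonalAut_eq_self_of_mem_hyperplaneClasses hX ha n hxL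
  have hμx : (BettiUniverse.pull (diagonalAut F ha) n).baseChange ℂ x = μ • x :=
    Module.End.mem_eigenspace_iff.mp hxE
  rw [hfix] at hμx
  have h0 : (μ - 1) • x = 0 := by rw [sub_smul, one_smul, ← hμx, sub_self]
  rw [Submodule.mem_bot]
  exact (smul_eq_zero.mp h0).resolve_left (sub_ne_zero.mpr hμ)

/-! ### §3 The invariant line: `E_1 = ι^* Hⁿ(ℙⁿ⁺¹)` when no invariant numerator survives the Jacobian ideal -/

/-- **The invariant part of `Hⁿ(Y)` under a diagonal symmetry whose invariant numerators all lie in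
the Jacobian ideal is exactly the line of hyperplane classes** (Carlson–Toledo §2 for the cyclic
covers: "`H^{n+1}(Y,ℂ)_0 = ⊕_{μ ≠ 1} H(μ)`" — the primitive cohomology has no invariants; Voisin II
Thm. 6.10: numerators in `J_F` give residues one step deeper in the Hodge filtration). Precisely:
granted the kernel package, if for every `1 ≤ l ≤ n + 1`, `k + n + 2 = l d`, every `P ∈ S^k` with
`T_a P = P` lies in `J_F`, then `ker(σ_a^* ⊗ ℂ − 1) = β⁻¹(ι^* Hⁿ(ℙⁿ⁺¹(ℂ); ℂ))`. Proof: descending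
induction on the level, `E_1 ∩ F^{n+1−l} ⊆ res_l((S^k)_1) + L ⊆ F^{n+2−l} ∩ E_1 + L ⊆ L`, starting
from `F^{n+1} = 0` and ending at `F⁰ = Hⁿ`. [cite: CarlsonToledo1999, §2 (held text p0005)]
[cite: VoisinHodgeII2003, §6.1.3 Thm. 6.10 (held text chunk p0159)] -/
theorem eigenspace_one_eq_hyperplaneClasses_of_residueKernel
    (hG : Griffiths1969_residueKernel_eq_jacobianIdeal) (hHD : exists_isReal_hodgeModel)
    (hn : 1 ≤ n) (hF : F.IsHomogeneous d)
    (hJ : ∀ z : Fin (n + 2) → ℂ, z ≠ 0 → MvPolynomial.eval z F = 0 →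
      ∃ j, MvPolynomial.eval z (MvPolynomial.pderiv j F) ≠ 0)
    (hX : IsSmoothProjective n (SmoothHypersurface.hypersurface F))
    {a : Fin (n + 2) → ℂˣ} (ha : a ∈ diagonalStabilizer F)
    (hinv : ∀ (l k : ℕ) (P : MvPolynomial (Fin (n + 2)) ℂ), 1 ≤ l → l ≤ n + 1 → k + (n + 2) = l * d →
      P.IsHomogeneous k → P ∈ Module.End.eigenspace (twistedDiagonalAction a) 1 →
      P ∈ UniversalHypersurface.jacobianIdeal F) :
    Module.End.eigenspace ((BettiUniverse.pull (diagonalAut F ha) n).baseChange ℂ) 1 =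
      (LinearMap.range (complexBetti.map (SmoothHypersurface.hypersurfaceι F) n).hom).map
        (ofRatClassBaseChangeEquiv hX n).symm.toLinearMap := by
  classical
  set X := SmoothHypersurface.hypersurface F with hXdef
  set A := BettiUniverse.realHodgeModel hHD hX with hAdef
  set H := BettiUniverse.hodge hHD hX n with hHdef
  set gC := (BettiUniverse.pull (diagonalAut F ha) n).baseChange ℂ with hgC
  set T := twistedDiagonalAction a with hTdef
  set β := ofRatClassBaseChangeEquiv hX n with hβ
  set L : Submodule ℂ (ℂ ⊗[ℚ] ↥(bettiCohomology X n)) :=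
    (LinearMap.range (complexBetti.map (SmoothHypersurface.hypersurfaceι F) n).hom).map
      β.symm.toLinearMap with hLdef
  obtain ⟨res, -, h2, h3, h4⟩ := hG n d hn F hF hJ hX A
  have memF : ∀ (m : ℕ) (x : ℂ ⊗[ℚ] ↥(bettiCohomology X n)),
      x ∈ H.F (m : ℤ) ↔ A.pullback n (β x) ∈ A.hodgeFiltration n m := by
    intro m x
    rw [hHdef, BettiUniverse.hodge_F, HodgeModel.mem_ratF_iff, Int.toNat_natCast]
    rfl
  have hβg : ∀ y, β (gC y) = complexBetti.map (diagonalAut F ha) n (β y) := fun y ↦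
    HodgeModel.ofRatClassBaseChange_baseChange_map (diagonalAut F ha) n y
  have hL1 : ∀ y ∈ L, gC y = y := fun y hy ↦
    baseChange_pull_diagonalAut_eq_self_of_mem_hyperplaneClasses hX ha n hy
  have hsymmL : ∀ z ∈ LinearMap.range (complexBetti.map (SmoothHypersurface.hypersurfaceι F) n).hom,
      β.symm z ∈ L := fun z hz ↦ Submodule.mem_map_of_mem hz
  -- the descending induction on the Hodge level
  have key : ∀ j : ℕ, j ≤ n + 1 → ∀ x, x ∈ Module.End.eigenspace gC 1 →
      x ∈ H.F ((n + 1 - j : ℕ) : ℤ) → x ∈ L := by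
    intro j
    induction j with
    | zero =>
      intro _ x _ hxF
      have hbot : H.F ((n + 1 - 0 : ℕ) : ℤ) = ⊥ := by
        rw [hHdef, BettiUniverse.hodge_F]
        exact HodgeModel.ratF_eq_bot _ hX n (by omega)
      rw [hbot, Submodule.mem_bot] at hxF
      rw [hxF]
      exact Submodule.zero_mem _
    | succ j ih =>
      intro hj x hxE hxF
      have hl1 : 1 ≤ j + 1 := by omega
      have hln : j + 1 ≤ n + 1 := by omega
      have hidx : n + 1 - (j + 1) = n + 1 - (j + 1) := rfl
      rw [memF] at hxF
      have h2x := h2 (j + 1) hl1 hln (β x) hxF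
      obtain ⟨u, hu, z, hz, huz⟩ := Submodule.mem_sup.mp h2x
      have hzL : β.symm z ∈ L := hsymmL z hz
      by_cases hdeg : n + 2 ≤ (j + 1) * d
      · -- there is exactly one numerator degree `k`
        obtain ⟨k, hk⟩ : ∃ k, k + (n + 2) = (j + 1) * d := ⟨(j + 1) * d - (n + 2), by omega⟩
        set Sk := homogeneousSubmodule (Fin (n + 2)) ℂ k with hSk
        have hsup : (⨆ (k' : ℕ) (_ : k' + (n + 2) = (j + 1) * d),
            (homogeneousSubmodule (Fin (n + 2)) ℂ k').map (res (j + 1))) = Sk.map (res (j + 1)) := by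
          refine le_antisymm (iSup_le fun k' ↦ iSup_le fun hk' ↦ ?_)
            (le_iSup_of_le k (le_iSup_of_le hk le_rfl))
          obtain rfl : k' = k := by omega
          exact le_rfl
        rw [hsup] at hu
        obtain ⟨P, hP, rfl⟩ := Submodule.mem_map.mp hu
        set ρ : MvPolynomial (Fin (n + 2)) ℂ →ₗ[ℂ] ℂ ⊗[ℚ] ↥(bettiCohomology X n) :=
          β.symm.toLinearMap ∘ₗ res (j + 1) with hρ
        have hβρ : ∀ Q, β (ρ Q) = res (j + 1) Q := fun Q ↦ by
          rw [hρ, LinearMap.comp_apply, LinearEquiv.coe_toLinearMap, LinearEquiv.apply_symm_apply]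
        have hequiv : ∀ Q ∈ Sk, gC (ρ Q) = ρ (T Q) := by
          intro Q hQ
          apply β.injective
          rw [hβg, hβρ, hβρ, hTdef, twistedDiagonalAction_apply, map_smul]
          exact h3 a ha (j + 1) k Q hl1 hln hk ((mem_homogeneousSubmodule k Q).mp hQ)
        have heig : ∀ (ν : ℂ) (Q : MvPolynomial (Fin (n + 2)) ℂ), Q ∈ Module.End.eigenspace T ν →
            Q ∈ Sk → ρ Q ∈ Module.End.eigenspace gC ν := by
          intro ν Q hQν hQ
          rw [Module.End.mem_eigenspace_iff, hequiv Q hQ, Module.End.mem_eigenspace_iff.mp hQν, map_smul]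
        -- `x = ρ P + β⁻¹ z`
        have hx : x = ρ P + β.symm z := by
          apply β.injective
          rw [map_add, hβρ, LinearEquiv.apply_symm_apply, huz]
        -- `ρ P` is invariant, hence equals `ρ (P_1)`
        have hρPE : ρ P ∈ Module.End.eigenspace gC 1 := by
          have h : ρ P = x - β.symm z := by rw [hx, add_sub_cancel_right]
          rw [h]
          refine Submodule.sub_mem _ hxE ?_
          rw [Module.End.mem_eigenspace_iff, one_smul]
          exact hL1 _ hzL
        set s := P.support.image (diagonalCharacter a) with hs
        have hsum : ρ P = ∑ ν ∈ s, ρ (eigenComponent a ν P) := by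
          rw [← map_sum, sum_eigenComponent a P]
        have hterms : ∀ ν ∈ s, ρ (eigenComponent a ν P) ∈ Module.End.eigenspace gC ν := fun ν _ ↦
          heig ν _ (eigenComponent_mem_eigenspace a ν P) (eigenComponent_mem_homogeneousSubmodule a ν hP)
        have hsumE : ∑ ν ∈ s, ρ (eigenComponent a ν P) ∈ Module.End.eigenspace gC 1 := hsum ▸ hρPE
        have hcomp := sum_eq_of_sum_mem_eigenspace gC s (fun ν ↦ ρ (eigenComponent a ν P)) hterms hsumE
        rw [← hsum] at hcomp
        -- the invariant numerator `P_1` lies in `J_F`, so `ρ P_1 ∈ F^{n+2-l}`, one level up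
        have hP1 : eigenComponent a 1 P ∈ UniversalHypersurface.jacobianIdeal F :=
          hinv (j + 1) k _ hl1 hln hk
            ((mem_homogeneousSubmodule k _).mp (eigenComponent_mem_homogeneousSubmodule a 1 hP))
            (eigenComponent_mem_eigenspace a 1 P)
        have hρP1F : ρ (eigenComponent a 1 P) ∈ H.F ((n + 1 - j : ℕ) : ℤ) := by
          rw [memF, hβρ, show n + 1 - j = n + 2 - (j + 1) by omega]
          exact (h4 (j + 1) k _ hl1 hln hk ((mem_homogeneousSubmodule k _).mp
            (eigenComponent_mem_homogeneousSubmodule a 1 hP))).mpr hP1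
        have hρP1L : ρ (eigenComponent a 1 P) ∈ L :=
          ih (by omega) _ (heig 1 _ (eigenComponent_mem_eigenspace a 1 P)
            (eigenComponent_mem_homogeneousSubmodule a 1 hP)) hρP1F
        have hρPL : ρ P ∈ L := by
          rw [hcomp]
          split_ifs
          · exact hρP1L
          · exact Submodule.zero_mem _
        rw [hx]
        exact Submodule.add_mem _ hρPL hzL
      · -- no numerator degree: `x` is a hyperplane class
        have hsup : (⨆ (k' : ℕ) (_ : k' + (n + 2) = (j + 1) * d),
            (homogeneousSubmodule (Fin (n + 2)) ℂ k').map (res (j + 1))) = ⊥ :=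
          le_bot_iff.mp (iSup_le fun k' ↦ iSup_le fun hk' ↦ by omega)
        rw [hsup, Submodule.mem_bot] at hu
        rw [hu, zero_add] at huz
        have hx : x = β.symm z := by rw [huz, LinearEquiv.symm_apply_apply]
        rw [hx]
        exact hzL
  refine le_antisymm ?_ ?_
  · intro x hxE
    refine key (n + 1) le_rfl x hxE ?_
    have htop : H.F ((n + 1 - (n + 1) : ℕ) : ℤ) = ⊤ := by
      rw [hHdef, BettiUniverse.hodge_F]
      exact HodgeModel.ratF_of_nonpos _ hX n (by omega)
    rw [htop]
    exact Submodule.mem_top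
  · intro y hy
    rw [Module.End.mem_eigenspace_iff, one_smul]
    exact hL1 y hy

/-- **For an even-dimensional smooth hypersurface the invariant part is a LINE**: under the
hypotheses of `eigenspace_one_eq_hyperplaneClasses_of_residueKernel` with `n = 2m` and `F`
irreducible, `dim_ℂ ker(σ_a^* ⊗ ℂ − 1) = 1` — the `1`-eigenspace is `β⁻¹(ι^* H^{2m}(ℙ^{2m+1}(ℂ); ℂ))`,
`ι^*` is injective on `H^{2m}(ℙ^{2m+1}(ℂ); ℂ)` (Voisin II Cor. 1.25, the tree's `map_ne_zero_of_le`: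
the degree of `Y` is non-zero), and `H^{2m}(ℙ^{2m+1}(ℂ); ℂ) ≅ ℂ`. (Carlson–Toledo §2, `n = 1` of the
paper: `H²(X_F) = ℂ·h ⊕ ⊕_{μ ≠ 1} H(μ)`.) [cite: CarlsonToledo1999, §2 (held text p0005)]
[cite: VoisinHodgeII2003, §1.2.3 Cor. 1.25] -/
theorem finrank_eigenspace_one_eq_one_of_residueKernel
    (hG : Griffiths1969_residueKernel_eq_jacobianIdeal) (hHD : exists_isReal_hodgeModel)
    {m : ℕ} (hnm : n = 2 * m) (hn : 1 ≤ n) (hF : F.IsHomogeneous d) (hirr : Irreducible F)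
    (hJ : ∀ z : Fin (n + 2) → ℂ, z ≠ 0 → MvPolynomial.eval z F = 0 →
      ∃ j, MvPolynomial.eval z (MvPolynomial.pderiv j F) ≠ 0)
    (hX : IsSmoothProjective n (SmoothHypersurface.hypersurface F))
    {a : Fin (n + 2) → ℂˣ} (ha : a ∈ diagonalStabilizer F)
    (hinv : ∀ (l k : ℕ) (P : MvPolynomial (Fin (n + 2)) ℂ), 1 ≤ l → l ≤ n + 1 → k + (n + 2) = l * d →
      P.IsHomogeneous k → P ∈ Module.End.eigenspace (twistedDiagonalAction a) 1 →
      P ∈ UniversalHypersurface.jacobianIdeal F) :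
    Module.finrank ℂ ↥(Module.End.eigenspace ((BettiUniverse.pull (diagonalAut F ha) n).baseChange ℂ) 1) = 1 := by
  rw [eigenspace_one_eq_hyperplaneClasses_of_residueKernel hG hHD hn hF hJ hX ha hinv,
    LinearEquiv.finrank_map_eq]
  subst hnm
  have hinj : Function.Injective (complexBetti.map (SmoothHypersurface.hypersurfaceι F) (2 * m)).hom := by
    refine (injective_iff_map_eq_zero _).mpr fun α hα ↦ ?_
    by_contra hα0
    exact map_ne_zero_of_le hX hF hirr inferInstance (SmoothHypersurface.hypersurfaceι F)
      (SmoothHypersurface.range_hypersurfaceι _) (p := m) (by omega) hα0 hα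
  rw [LinearMap.finrank_range_of_inj hinj]
  exact finrank_complexBetti_projectiveSpace_two_mul (2 * m + 1) (k := m) (by omega)

/-- **The invariant line over `ℚ`**: under the same hypotheses
`dim_ℚ H^{2m}(Y(ℂ); ℚ)^{σ_a^*} = 1` (the eigenvalue `1` is rational, and eigenspaces commute with
`⊗ ℂ`) — the shape of Carlson–Toledo's clause "`dim_ℚ H²(X_F;ℚ)^{σ_F^*} = 1`" in the tree
(`carlsonToledo1999_finrank_eigenspace_deck_one`). [cite: CarlsonToledo1999, §2 (held text p0005)]
[cite: VoisinHodgeII2003, §1.2.3 Cor. 1.25] -/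
theorem finrank_eigenspace_pull_one_eq_one_of_residueKernel
    (hG : Griffiths1969_residueKernel_eq_jacobianIdeal) (hHD : exists_isReal_hodgeModel)
    {m : ℕ} (hnm : n = 2 * m) (hn : 1 ≤ n) (hF : F.IsHomogeneous d) (hirr : Irreducible F)
    (hJ : ∀ z : Fin (n + 2) → ℂ, z ≠ 0 → MvPolynomial.eval z F = 0 →
      ∃ j, MvPolynomial.eval z (MvPolynomial.pderiv j F) ≠ 0)
    (hX : IsSmoothProjective n (SmoothHypersurface.hypersurface F))
    {a : Fin (n + 2) → ℂˣ} (ha : a ∈ diagonalStabilizer F)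
    (hinv : ∀ (l k : ℕ) (P : MvPolynomial (Fin (n + 2)) ℂ), 1 ≤ l → l ≤ n + 1 → k + (n + 2) = l * d →
      P.IsHomogeneous k → P ∈ Module.End.eigenspace (twistedDiagonalAction a) 1 →
      P ∈ UniversalHypersurface.jacobianIdeal F) :
    Module.finrank ℚ ↥(Module.End.eigenspace (BettiUniverse.pull (diagonalAut F ha) n) 1) = 1 := by
  haveI : Module.Finite ℚ ↥(bettiCohomology (SmoothHypersurface.hypersurface F) n) :=
    BettiUniverse.finite hX n
  rw [← finrank_eigenspace_baseChange_one]
  exact finrank_eigenspace_one_eq_one_of_residueKernel hG hHD hnm hn hF hirr hJ hX ha hinv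

end HodgeTheory

end Literature.AlgebraicGeometry.HodgeTheory

end
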